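import Mathlib
import HarnessLib
import HarnessLib.Audit
import Summits.Langlands.Statement
import Summits.Langlands.Langlands.Theorems.SplitPrimeDescentLadder
import Summits.Langlands.Langlands.Theorems.SplitPrimeDescentLadderResidual
import Summits.Langlands.Langlands.Theorems.SplitPrimeDescentLadderTwistModelPrelude
import Summits.Langlands.Langlands.Theorems.SplitPrimeDescentLadderTwistModel
import Summits.Langlands.Langlands.Theorems.SplitPrimeDescentLadderFieldSupply
import Literature.NumberTheory.GaloisRepresentations.ArtinReciprocityCharacterProofs
import Literature.NumberTheory.GaloisRepresentations.AbsGaloisOuterConj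
import Literature.NumberTheory.GaloisRepresentations.ArtinRestriction
import Literature.NumberTheory.Automorphic.StrongArtinGL2
import Literature.NumberTheory.Automorphic.ReciprocityGLnPatchingFamily
import Literature.NumberTheory.Automorphic.ReciprocityGLnPatchingGalois
import Literature.NumberTheory.GaloisRepresentations.SGeneralQuadraticFamily
import Summits.Langlands.Langlands.Theorems.SplitPrimeDescentLadderDyadic

/-!
# `SplitPrimeDescentLadder` v4 — D₂ `CofinalResidualDoorTwo`: PRELUDE at 2 (clause defs + 2-adic units + exponent of A₅)

Census twin (ii)-a of lens-1 g36's birth `birth_CofinalResidualDoorTwo.lean` (sha256 fe67cee59580e72c…), per RUNME §6: the clause defs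
`FieldClausesTwo` / `TwoSplit` / `GaloisClausesTwo` / `ResClauseTwo` and `section PreludeTwo` VERBATIM; the local copy of the crux
`CofinalResidualDoorTwo` is DROPPED in favour of the tree decl `Summit.Langlands.Langlands.Theorems.SplitPrimeDescentLadder.CofinalResidualDoorTwo`
(Theorems/SplitPrimeDescentLadderDyadic.lean, p835035; texts identical). Part (ii)-b `…DyadicTwistModel.lean` carries T1₂/T2₂ and the assemblies.
-/

set_option linter.dupNamespace false -- project-wide option; `Summit.Langlands.Langlands` is the mandated namespace

noncomputable section

namespace Summit.Langlands.Langlands.Theorems.SplitPrimeDescentLadder.V4Birth.CofinalResidualDoorTwo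

open scoped MatrixGroups NumberField
open NumberField IsDedekindDomain Filter Polynomial
open Literature.NumberTheory.GaloisRepresentations Literature.NumberTheory.Automorphic
open Literature.NumberTheory.GaloisRepresentations.QuadraticFamily
open Summit.Langlands.Langlands.Theorems.SplitPrimeDescentLadder.V3Birth.CofinalResidualDoor

/-! ## The crux's clause groups, verbatim -/

/-- FIELD clauses of D₂ for the member at `p` (verbatim): `M` CM, Galois, cyclic, squarefree degree with odd prime
divisors in the window, `p` split completely, `√-d ∈ M` with `d ≡ 7 (mod 8)`. [folklore] -/
def FieldClausesTwo (p : IsDedekindDomain.HeightOneSpectrum (NumberField.RingOfIntegers ℚ)) (M : Type) [Field M] [NumberField M] : Prop :=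
  NumberField.IsCMField M ∧ IsGalois ℚ M ∧ IsCyclic (M ≃ₐ[ℚ] M) ∧ Squarefree (Module.finrank ℚ M) ∧ (∀ ℓ : ℕ, ℓ.Prime → ℓ ∣ Module.finrank ℚ M → ℓ = 2 ∨ (2 ^ Ideal.absNorm p.asIdeal ≤ ℓ ∧ ℓ < 2 ^ (Ideal.absNorm p.asIdeal + 1))) ∧ (∀ w : IsDedekindDomain.HeightOneSpectrum (NumberField.RingOfIntegers M), w.asIdeal.under (NumberField.RingOfIntegers ℚ) = p.asIdeal → w.asIdeal.inertiaDeg (NumberField.RingOfIntegers ℚ) = 1 ∧ w.asIdeal.ramificationIdx (NumberField.RingOfIntegers ℚ) = 1) ∧ (∃ (d : ℕ) (z : M), d % 8 = 7 ∧ z ^ 2 + (d : M) = 0)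

/-- `2` splits completely in `M`. [folklore] -/
def TwoSplit (M : Type) [Field M] [NumberField M] : Prop :=
  ∀ w : IsDedekindDomain.HeightOneSpectrum (NumberField.RingOfIntegers M), (2 : NumberField.RingOfIntegers M) ∈ w.asIdeal → w.asIdeal.inertiaDeg (NumberField.RingOfIntegers ℚ) = 1 ∧ w.asIdeal.ramificationIdx (NumberField.RingOfIntegers ℚ) = 1

/-- GALOIS clauses of D₂ (verbatim): `τ = χ ⊗ σ|_M` entrywise, `τ₂` a `2`-adic `ι`-model of `τ` with finite image,
`χ, τ₂` unramified above `p`, `τ₂` projectively `A₅`, `τ₂` unramified and `2`-adically distinguished above `2`. [folklore] -/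
def GaloisClausesTwo (ι : PadicAlgCl 2 ≃+* ℂ) (σ : Literature.NumberTheory.GaloisRepresentations.FramedGaloisRep ℚ ℂ 2)
    (p : IsDedekindDomain.HeightOneSpectrum (NumberField.RingOfIntegers ℚ)) (M : Type) [Field M] [NumberField M]
    (χ : Literature.NumberTheory.GaloisRepresentations.FramedGaloisRep M ℂ 1)
    (τ : Literature.NumberTheory.GaloisRepresentations.FramedGaloisRep M ℂ 2)
    (τ₂ : Literature.NumberTheory.GaloisRepresentations.FramedGaloisRep M (PadicAlgCl 2) 2) : Prop :=
  (∀ g : Field.absoluteGaloisGroup M, ((τ g : Matrix.GeneralLinearGroup (Fin 2) ℂ) : Matrix (Fin 2) (Fin 2) ℂ) = ((Matrix.GeneralLinearGroup.det (χ g) : ℂˣ) : ℂ) • ((Literature.NumberTheory.GaloisRepresentations.FramedGaloisRep.restrictField M σ g : Matrix.GeneralLinearGroup (Fin 2) ℂ) : Matrix (Fin 2) (Fin 2) ℂ)) ∧ (∀ g : Field.absoluteGaloisGroup M, ((τ₂ g : Matrix.GeneralLinearGroup (Fin 2) (PadicAlgCl 2)) : Matrix (Fin 2) (Fin 2) (PadicAlgCl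 2)).map ι = ((τ g : Matrix.GeneralLinearGroup (Fin 2) ℂ) : Matrix (Fin 2) (Fin 2) ℂ)) ∧ Finite τ₂.toMonoidHom.range ∧ (∀ w : IsDedekindDomain.HeightOneSpectrum (NumberField.RingOfIntegers M), w.asIdeal.under (NumberField.RingOfIntegers ℚ) = p.asIdeal → χ.IsUnramifiedAt w ∧ τ₂.IsUnramifiedAt w) ∧ Nonempty ((Matrix.ProjGenLinGroup.mk.comp τ₂.toMonoidHom).range ≃* alternatingGroup (Fin 5)) ∧ (∀ w : IsDedekindDomain.HeightOneSpectrum (NumberField.RingOfIntegers M), (2 : NumberField.RingOfIntegers M) ∈ w.asIdeal → τ₂.IsUnramifiedAt w ∧ ∃ t d : PadicAlgCl 2, τ₂.HasFrobCharpolyAt w (Polynomial.X ^ 2 - Polynomial.C t * Polynomial.X + Polynomial.C d) ∧ ‖t ^ 2 - 4 * d‖ = 1)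

/-- RESIDUAL-AUTOMORPHY clause of D₂ (verbatim): some tame level `𝒰` of `GL₂/M` at `p = 2` carries a non-Eisenstein
maximal ideal `𝔪 ⊂ 𝕋(U^2)` with a residual representation `ρ̄_𝔪` that is a reduction of `τ₂`. [folklore] -/
def ResClauseTwo (M : Type) [Field M] [NumberField M]
    (τ₂ : Literature.NumberTheory.GaloisRepresentations.FramedGaloisRep M (PadicAlgCl 2) 2) : Prop :=
  ∃ 𝒰 : Literature.NumberTheory.Automorphic.BigHeckeGLn.TameLevel 2 M 2, ∃ 𝔪 : Ideal (Literature.NumberTheory.Automorphic.CompletedCohomologyHeckeAlgebraGLn 𝒰), 𝒰.IsNonEisenstein 𝔪 ∧ ∃ (k : Type) (_ : Field k) (_ : TopologicalSpace k) (_ : DiscreteTopology k) (ιk : Literature.NumberTheory.GaloisRepresentations.padicAlgClResidueField 2 →+* k) (ψ : Literature.NumberTheory.Automorphic.CompletedCohomologyHeckeAlgebraGLn 𝒰 →+* k) (ρ : Literature.NumberTheory.GaloisRepresentations.FramedGaloisRep M k 2), 𝒰.IsResidualRepAt 𝔪 ψ ρ ∧ τ₂.IsReductionOf ιk (ρ :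 Field.absoluteGaloisGroup M →* Matrix.GeneralLinearGroup (Fin 2) k)

/-! ## Prelude at `2`: units of `ar ℚ₂` and the exponent of `A₅` -/

section PreludeTwo

open Finset Equiv Equiv.Perm

/-- `‖(15 : ar ℚ₂)‖ = 1`. [folklore] -/
theorem norm_fifteen_padicAlgCl_two : ‖(15 : PadicAlgCl 2)‖ = 1 := by
  have h : (15 : PadicAlgCl 2) = algebraMap ℚ_[2] (PadicAlgCl 2) ((15 : ℤ) : ℚ_[2]) := by
    rw [Int.cast_ofNat, map_ofNat]
  rw [h, norm_algebraMap']
  refine le_antisymm (Padic.norm_int_le_one _) ?_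
  by_contra hlt
  have hdvd : ((2 : ℕ) : ℤ) ∣ (15 : ℤ) := Padic.norm_intCast_lt_one_iff.1 (lt_of_not_ge hlt)
  omega

/-- In `ar ℚ₂`: a `15`-th root of unity congruent to `1` is `1` (`‖15‖₂ = 1`). [folklore] -/
theorem eq_one_of_pow_fifteen_of_norm_sub_one_lt {u : PadicAlgCl 2} (hu : u ^ 15 = 1)
    (hlt : ‖u - 1‖ < 1) : u = 1 := by
  by_contra hne
  have hnorm : ‖u‖ = 1 := norm_eq_one_of_pow_eq_one' (by norm_num) hu
  have hS : (∑ i ∈ range 15, u ^ i) = 0 := by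
    have h := geom_sum_mul u 15
    rw [hu, sub_self] at h
    exact (mul_eq_zero.1 h).resolve_right (sub_ne_zero.2 hne)
  have hdiff : ‖(∑ i ∈ range 15, u ^ i) - 15‖ < 1 := by
    have hrw : (∑ i ∈ range 15, u ^ i) - 15 = ∑ i ∈ range 15, (u ^ i - 1) := by
      rw [Finset.sum_sub_distrib, Finset.sum_const, Finset.card_range]; norm_num
    rw [hrw]
    refine lt_of_le_of_lt (IsUltrametricDist.norm_sum_le_of_forall_le_of_nonempty
      ⟨0, by simp⟩ fun i _ => norm_pow_sub_one_le hnorm.le i) hlt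
  rw [hS, zero_sub, norm_neg, norm_fifteen_padicAlgCl_two] at hdiff
  exact lt_irrefl _ hdiff

/-- **Key unit lemma at `2`.** `ζ ^ 30 = 1`, `ζ ≠ 1`, `ζ ≠ -1` in `ar ℚ₂` force `‖ζ - 1‖ = 1`: the odd part
`ζ ^ 16` is `≡ 1`, hence `= 1`, so `ζ ^ 2 = 1`, contradiction. [folklore] -/
theorem norm_sub_one_eq_one_of_pow_thirty {ζ : PadicAlgCl 2} (h30 : ζ ^ 30 = 1) (h1 : ζ ≠ 1)
    (h2 : ζ + 1 ≠ 0) : ‖ζ - 1‖ = 1 := by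
  have hnorm : ‖ζ‖ = 1 := norm_eq_one_of_pow_eq_one' (by norm_num) h30
  have hle : ‖ζ - 1‖ ≤ 1 := by
    rw [sub_eq_add_neg]
    refine (IsUltrametricDist.norm_add_le_max ζ (-1)).trans ?_
    rw [norm_neg, norm_one, hnorm, max_self]
  refine le_antisymm hle (not_lt.1 fun hlt => ?_)
  have hu15 : (ζ ^ 16) ^ 15 = 1 := by
    rw [← pow_mul, show 16 * 15 = 30 * 8 by norm_num, pow_mul, h30, one_pow]
  have hu : ζ ^ 16 = 1 :=
    eq_one_of_pow_fifteen_of_norm_sub_one_lt hu15 (lt_of_le_of_lt (norm_pow_sub_one_le hnorm.le 16) hlt)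
  have hζ2 : ζ ^ 2 = 1 := by
    have h32 : ζ ^ 32 = 1 := by
      rw [show (32 : ℕ) = 16 * 2 by norm_num, pow_mul, hu, one_pow]
    have : ζ ^ 30 * ζ ^ 2 = 1 := by rw [← pow_add]; exact h32
    simpa [h30] using this
  have hfac : (ζ - 1) * (ζ + 1) = 0 := by
    have : (ζ - 1) * (ζ + 1) = ζ ^ 2 - 1 := by ring
    rw [this, hζ2, sub_self]
  rcases mul_eq_zero.1 hfac with h | h
  · exact h1 (sub_eq_zero.1 h)
  · exact h2 h

/-- **Distinguishedness survives the `2`-adic transport**: roots of unity `a ≠ b`, `a ≠ -b`, with `a ^ 30 = b ^ 30`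
satisfy `‖a - b‖₂ = 1`. [folklore] -/
theorem norm_sub_eq_one_of_rootsOfUnity_two {a b : PadicAlgCl 2} {n : ℕ} (hn : n ≠ 0) (_ha : a ^ n = 1)
    (hb : b ^ n = 1) (h30 : a ^ 30 = b ^ 30) (hab : a ≠ b) (h2 : a + b ≠ 0) :
    ‖a - b‖ = 1 := by
  have hb0 : b ≠ 0 := fun h => by rw [h, zero_pow hn] at hb; exact zero_ne_one hb
  have hnb : ‖b‖ = 1 := norm_eq_one_of_pow_eq_one' hn hb
  set ζ := a * b⁻¹ with hζ
  have haζ : a = b * ζ := by rw [hζ]; field_simp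
  have hζ30 : ζ ^ 30 = 1 := by
    rw [hζ, mul_pow, h30, inv_pow, mul_inv_cancel₀ (pow_ne_zero _ hb0)]
  have hζ1 : ζ ≠ 1 := fun h => hab (by rw [haζ, h, mul_one])
  have hζ2 : ζ + 1 ≠ 0 := by
    intro h
    apply h2
    have : a + b = b * (ζ + 1) := by rw [haζ]; ring
    rw [this, h, mul_zero]
  have hsub : a - b = b * (ζ - 1) := by rw [haζ]; ring
  rw [hsub, norm_mul, hnb, one_mul, norm_sub_one_eq_one_of_pow_thirty hζ30 hζ1 hζ2]

/-- **`A₅` has exponent dividing `30`** (cycle types of even permutations of `5` letters: `()`, `(3)`, `(5)`,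
`(2,2)`; a part `4` would be a `4`-cycle, which is odd). [folklore] -/
theorem pow_thirty_eq_one_of_mem_alternatingGroup (g : Perm (Fin 5)) (hg : g ∈ alternatingGroup (Fin 5)) :
    g ^ 30 = 1 := by
  classical
  rw [Equiv.Perm.mem_alternatingGroup] at hg
  have hparts : ∀ n ∈ g.cycleType, n ∣ 30 := by
    intro n hn
    have h2 : 2 ≤ n := two_le_of_mem_cycleType hn
    have h5 : n ≤ 5 := by
      have hs : g.cycleType.sum = g.support.card := sum_cycleType g
      have hle : g.support.card ≤ 5 := by
        simpa using Finset.card_le_univ g.support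
      have := Multiset.le_sum_of_mem hn
      omega
    interval_cases n
    · exact ⟨15, rfl⟩
    · exact ⟨10, rfl⟩
    · exfalso
      have hs : g.cycleType.sum = g.support.card := sum_cycleType g
      have hle : g.support.card ≤ 5 := by simpa using Finset.card_le_univ g.support
      have hct : g.cycleType = {4} := by
        obtain ⟨t, ht⟩ := Multiset.exists_cons_of_mem hn
        have hsum : t.sum + 4 ≤ 5 := by
          have := congrArg Multiset.sum ht
          simp [Multiset.sum_cons] at this
          omega
        have ht0 : t = 0 := by
          rcases Multiset.empty_or_exists_mem t with h | ⟨m, hm⟩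
          · exact h
          · have h2m : 2 ≤ m := two_le_of_mem_cycleType (σ := g) (by rw [ht]; exact Multiset.mem_cons_of_mem hm)
            have := Multiset.le_sum_of_mem hm
            omega
        rw [ht, ht0]; rfl
      have hsign := sign_of_cycleType g
      rw [hct, hg] at hsign
      exact absurd hsign (by decide)
    · exact ⟨6, rfl⟩
  have hdvd : orderOf g ∣ 30 := by
    rw [← lcm_cycleType]
    exact Multiset.lcm_dvd.2 hparts
  exact orderOf_dvd_iff_pow_eq_one.1 hdvd

/-- `x ^ 30 = 1` in `A₅`. [folklore] -/
theorem alternatingGroup_five_pow_thirty (g : alternatingGroup (Fin 5)) : g ^ 30 = 1 := by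
  apply Subtype.ext
  rw [SubgroupClass.coe_pow]
  exact pow_thirty_eq_one_of_mem_alternatingGroup g.1 g.2

end PreludeTwo

end Summit.Langlands.Langlands.Theorems.SplitPrimeDescentLadder.V4Birth.CofinalResidualDoorTwo

end
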